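import Summits.Ventures.DiscreteObjects.Hadamard.ElemAbelianSummary668
import Summits.Ventures.DiscreteObjects.Hadamard.ElemAbelianRank2_11

/-!
# Hadamard 668 census, family F12 — Sylow subgroups for every prime `p ≥ 11`: no `C_p × C_p`, no `C_{p²}` (kernel summary)

Framing: lottery ticket; floor = certified bounds/negative ranges.

Cell pub-namedobj (venture DiscreteObjects), target (H), hadamard gen 16.  ONE QUOTABLE STATEMENT (supersedes the words of
`ElemAbelianSummary668` by including `p = 11`): **`no_hadamard668_elemAbelian_rank2_ge11`** — for every prime `p ≥ 11`,
a Hadamard matrix of order `668` has no two signed-permutation automorphisms with `p`-th powers `1`, commuting permutation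
parts, and independent row parts (`⟨α, β⟩ ≅ C_p × C_p`): `p = 11` is `no_hadamard668_elemAbelian_rank2_11`
(Burnside + line partition + orthogonality), `p ≥ 13` is `no_hadamard668_elemAbelian_rank2`.  Together with
`hadamard668_signedAut_not_dvd_orderOf_sq` (p268777: no element whose permutation pair has order divisible by `p²`,
`p ∈ {11,13,23,37,41,83,167}`) and the prime-order spectrum (`hadamard668_signedAut_prime_mem'`: only these primes `≥ 11`
occur): **for every prime `p ≥ 11` the Sylow `p`-subgroups of the signed automorphism group of any H(668) are trivial or
of order `p`** — the part of `|Aut H(668)|` coprime to `2·3·5·7` is squarefree and divides `11·13·23·37·41·83·167`.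
(`p ∈ {3, 5, 7}`: `C₇ × C₇` is excluded only at the summed orbit level, FAMILY-F12-G16; `C₃²`, `C₅²` open.)
Ours, not literature; no `sorry`.
-/

namespace Summit.Ventures.DiscreteObjects.Hadamard

open Finset BigOperators

open Literature.Combinatorics.Designs.GoethalsSeidel (IsHadamardMatrix)

variable {ι : Type*} [Fintype ι] [DecidableEq ι]

/-- **No rank-2 elementary abelian `p`-subgroup `C_p × C_p` of signed automorphisms of an H(668), for any prime
`p ≥ 11`.** -/
theorem no_hadamard668_elemAbelian_rank2_ge11 {H : Matrix ι ι ℤ} (hH : IsHadamardMatrix H)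
    (hι : Fintype.card ι = 668) (p : ℕ) (hp : p.Prime) (hp11 : 11 ≤ p)
    {α α' β β' : Equiv.Perm ι} {d₁ e₁ d₂ e₂ : ι → ℤ}
    (hA : IsSignedAut H α α' d₁ e₁) (hB : IsSignedAut H β β' d₂ e₂)
    (hα : α ^ p = 1) (hα' : α' ^ p = 1) (hβ : β ^ p = 1) (hβ' : β' ^ p = 1)
    (hc : Commute α β) (hc' : Commute α' β')
    (hind : ∀ a b : ℕ, a < p → b < p → α ^ a * β ^ b = 1 → a = 0 ∧ b = 0) : False := by
  by_cases h11 : p = 11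
  · subst h11
    exact no_hadamard668_elemAbelian_rank2_11 hH hι hA hB hα hα' hβ hβ' hc hc' hind
  · have hp13 : 13 ≤ p := by
      -- a prime p ≥ 11, p ≠ 11, is ≥ 13 (12 is not prime)
      rcases Nat.lt_or_ge p 13 with h | h
      · interval_cases p
        · exact absurd rfl h11
        · exact absurd hp (by norm_num)
      · exact h
    exact no_hadamard668_elemAbelian_rank2 hH hι p hp hp13 hA hB hα hα' hβ hβ' hc hc' hind

/-- **The `p`-part of the automorphism group for every prime `p ≥ 11` (packaging).**  (1) no `C_p × C_p`; (2) no element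
whose permutation pair has order divisible by `p²` for the primes `≥ 11` that occur at all. -/
theorem hadamard668_sylow_ge11_summary {H : Matrix ι ι ℤ} (hH : IsHadamardMatrix H) (hι : Fintype.card ι = 668) :
    (∀ (p : ℕ), p.Prime → 11 ≤ p → ∀ {α α' β β' : Equiv.Perm ι} {d₁ e₁ d₂ e₂ : ι → ℤ},
      IsSignedAut H α α' d₁ e₁ → IsSignedAut H β β' d₂ e₂ → α ^ p = 1 → α' ^ p = 1 → β ^ p = 1 → β' ^ p = 1 →
      Commute α β → Commute α' β' → (∀ a b : ℕ, a < p → b < p → α ^ a * β ^ b = 1 → a = 0 ∧ b = 0) → False) ∧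
    (∀ (p : ℕ), (p = 11 ∨ p = 13 ∨ p = 23 ∨ p = 37 ∨ p = 41 ∨ p = 83 ∨ p = 167) →
      ∀ {π κ : Equiv.Perm ι} {d e : ι → ℤ},
      IsSignedAut H π κ d e → ¬ p * p ∣ orderOf ((π, κ) : Equiv.Perm ι × Equiv.Perm ι)) := by
  refine ⟨?_, (hadamard668_sylow_large_summary hH hι).2⟩
  intro p hp hp11 α α' β β' d₁ e₁ d₂ e₂ hA hB hα hα' hβ hβ' hc hc' hind
  exact no_hadamard668_elemAbelian_rank2_ge11 hH hι p hp hp11 hA hB hα hα' hβ hβ' hc hc' hind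

end Summit.Ventures.DiscreteObjects.Hadamard
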